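import Mathlib
import HarnessLib

/-!
# The `O(N)` vector sum rule: crossing symmetry of `⟨φᵢ φⱼ φₖ φₗ⟩` as three scalar equations, and the
# linear-functional exclusion step (Kos–Poland–Simmons-Duffin, JHEP 06 (2014) 091, §2.1–§2.2)

Topic `MathematicalPhysics/QuantumFieldTheory`; definitions + theorems only (no named fact, no instance,
no `sorry`).  Pure finite-dimensional algebra over opaque "channel functions" of the cross-ratios — no
conformal-block theory is used or asserted; what a block IS stays the business of
`ConformalBootstrap3D/*` (for the `ℤ₂` system `σ–ε` the analogous, much finer statement is
`ConformalBootstrap3D/DualFunctional.lean`).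

SOURCE (read from the held text `paper:arxiv-1307.6856`, §2.1 "Statement of Crossing Symmetry" and §2.2
"Bounds from Convex Optimization").  F. Kos, D. Poland, D. Simmons-Duffin, *Bootstrapping the O(N) vector
models*, JHEP 06 (2014) 091 [KosPolandSimmonsduffin2014ON]:
* §2.1: for a scalar primary `φᵢ` in the vector representation of `O(N)`,
  `x₁₂^{2Δφ} x₃₄^{2Δφ} ⟨φᵢ(x₁)φⱼ(x₂)φₖ(x₃)φₗ(x₄)⟩ = Σ_{S⁺} λ² (δᵢⱼδₖₗ) g(u,v)
   + Σ_{T⁺} λ² (δᵢₗδⱼₖ + δᵢₖδⱼₗ − (2/N) δᵢⱼδₖₗ) g(u,v) + Σ_{A⁻} λ² (δᵢₗδⱼₖ − δᵢₖδⱼₗ) g(u,v)`,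
  "Swapping `(1,i) ↔ (3,k)`, we find two different conformal block expansions of a single four-point
  function which must agree with each other. Writing out this condition and isolating the coefficient of
  each tensor structure that appears, we obtain three equations which can be grouped into a vector
  'sum rule' `Σ_{S⁺} λ² V_S + Σ_{T⁺} λ² V_T + Σ_{A⁻} λ² V_A = 0`" with
  `V_S = (0, F⁻, F⁺)ᵀ`, `V_T = (F⁻, (1 − 2/N) F⁻, −(1 + 2/N) F⁺)ᵀ`, `V_A = (−F⁻, F⁻, −F⁺)ᵀ`,
  `F^±_{Δ,ℓ}(u,v) ≡ v^{Δφ} g_{Δ,ℓ}(u,v) ± u^{Δφ} g_{Δ,ℓ}(v,u)`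
  [cite: KosPolandSimmonsduffin2014ON, §2.1 (four-point decomposition, vector sum rule, `V_S, V_T, V_A, F^±`)].
* §2.2: isolate the unit operator, `0 = V_unit + Σ λ²_𝒪 V_𝒪` (`λ²_𝒪 > 0` in a unitary theory); "Try to
  find a linear functional `α` such that `α(V_unit) > 0`, `α(V_𝒪) ≥ 0` for all `𝒪` satisfying the
  assumption … If such a functional exists, the assumption is ruled out, since applying `α` … gives a
  contradiction"; the functionals used are finite combinations of derivatives at `z = z̄ = 1/2`
  [cite: KosPolandSimmonsduffin2014ON, §2.2].

RENDERING.  The cross-ratios `(u, v)` are real variables; a "channel function" is any `g : ℝ → ℝ → ℝ`.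
Under `(1,i) ↔ (3,k)` one has `u ↔ v` and `x₁₂^{2Δφ}x₃₄^{2Δφ} ↦ x₃₂^{2Δφ}x₁₄^{2Δφ}`, so for the
reduced correlator `f_{ijkl}(u,v) := x₁₂^{2Δφ}x₃₄^{2Δφ}⟨φᵢφⱼφₖφₗ⟩` crossing symmetry reads
`v^{Δφ} f_{ijkl}(u,v) = u^{Δφ} f_{kjil}(v,u)`; this identity, with `f` expanded on the three tensor
structures against the channel sums `G_S, G_T, G_A` (eq. of §2.1), is `CrossingAt` — the DEFINITION of
crossing symmetry in cross-ratio space used here, exactly the condition the paper "writes out".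

WHAT IS PROVED.
* §1 `kd`, `tS`, `tT`, `tA` (the three `O(N)` tensor structures of §2.1), `tT` symmetric and traceless
  (`sum_tT_diag`, needs `N ≠ 0`), `tA` antisymmetric; `tensor_independent` — for `2 ≤ N` the structures
  `δᵢⱼδₖₗ, δᵢₖδⱼₗ, δᵢₗδⱼₖ` are linearly independent (this is the "isolating the coefficient of each tensor
  structure" step; it FAILS for `N = 1`, where `tT = tA = 0` and crossing says only `F⁻[G_S] = 0` —
  private scope remarks `tT_eq_zero_of_one`, `crossingAt_one_iff`).
* §2 `Fm`/`Fp` (`F^∓`), `VS`/`VT`/`VA` (`VS_unit`: the unit operator's `V_S[1] = (0, v^{Δφ}−u^{Δφ},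
  v^{Δφ}+u^{Δφ})`), `sumRuleVec := V_S[G_S] + V_T[G_T] + V_A[G_A]` and its three components;
  `crossing_defect` — the POINTWISE identity
  `v^{Δφ} f_{ijkl}(u,v) − u^{Δφ} f_{kjil}(v,u) = δᵢⱼδₖₗ·(r₂+r₃)/2 + δᵢₖδⱼₗ·r₁ + δᵢₗδⱼₖ·(r₂−r₃)/2`
  (`r₁,r₂,r₃` the components of `sumRuleVec`); hence `sumRuleAt_of_crossingAt` (`2 ≤ N`),
  `crossingAt_of_sumRuleAt` (every `N`) and `crossingAt_iff_sumRuleAt` — crossing symmetry at `(u,v)`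
  IS the vector sum rule at `(u,v)`, channel by channel sums and all; `CrossingAt.swap`, `Fm_swap`
  (`F⁻` odd), `Fp_swap` (`F⁺` even), `sumRuleAt_swap_iff` — the conditions at `(v,u)` and at `(u,v)`
  coincide (mirror points carry no new information).
* §3 operator level: `Fm`, `Fp`, `VS`, `VT`, `VA` commute with the convergent channel expansions
  `G_R(u,v) = Σ_𝒪 λ²_𝒪 g_𝒪(u,v)` (`hasSum_Fm`, `hasSum_VS`, …), so crossing gives the paper's series form
  `Σ_{S⁺} λ² V_S + Σ_{T⁺} λ² V_T + Σ_{A⁻} λ² V_A = 0` (`vectorSumRule_hasSum`, `vectorSumRule_tsum`).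
* §4 the exclusion step of §2.2: `false_of_functional` — in ANY real vector space, a linear functional
  that is non-negative on every `V_𝒪`, strictly positive on `V_unit`, and APPLIES TERMWISE to
  `0 = V_unit + Σ λ² V_𝒪` (the hypothesis `HasSum (λ²_𝒪 · α(V_𝒪)) (−α(V_unit))`, which is what "applying
  `α`" to a convergent series requires) cannot exist; `pointFunctional` / `hasSum_pointFunctional` — finite
  combinations of point evaluations of the three components apply termwise with NO further hypothesis, and
  `false_of_pointFunctional` is the complete hypothesis-explicit exclusion for them (channel expansions at
  the evaluation points and their `u ↔ v` mirrors + crossing there + positivity ⇒ `False`).  Derivative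
  functionals (the paper's search space, §2.2) need termwise differentiability of the channel expansions,
  which is NOT supplied here (cf. the discussion of `AppliesTermwise` in `ConformalBootstrap3D/DualFunctional.lean`).
-/

namespace Literature.MathematicalPhysics.QuantumFieldTheory.ONVectorSumRule

open Finset

noncomputable section

variable {N : ℕ}

/-! ## §1 The three `O(N)` tensor structures -/

/-- Real Kronecker delta `δᵢⱼ` on `Fin N` (plumbing for the tensor structures of the cited §2.1). [folklore] -/
def kd (i j : Fin N) : ℝ := if i = j then 1 else 0

/-- `δᵢᵢ = 1`. Plumbing. [folklore] -/
@[simp] private theorem kd_self (i : Fin N) : kd i i = 1 := by simp [kd]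

/-- `δᵢⱼ = 0` for `i ≠ j`. Plumbing. [folklore] -/
private theorem kd_of_ne {i j : Fin N} (h : i ≠ j) : kd i j = 0 := by simp [kd, h]

/-- `δᵢⱼ = δⱼᵢ`. Plumbing. [folklore] -/
private theorem kd_comm (i j : Fin N) : kd i j = kd j i := by
  rcases eq_or_ne i j with rfl | h
  · simp
  · rw [kd_of_ne h, kd_of_ne h.symm]

/-- Singlet structure `δᵢⱼ δₖₗ` (channel `S⁺`). [cite: KosPolandSimmonsduffin2014ON, §2.1] -/
def tS (i j k l : Fin N) : ℝ := kd i j * kd k l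

/-- Symmetric-traceless structure `δᵢₗ δⱼₖ + δᵢₖ δⱼₗ − (2/N) δᵢⱼ δₖₗ` (channel `T⁺`).
[cite: KosPolandSimmonsduffin2014ON, §2.1] -/
def tT (i j k l : Fin N) : ℝ := kd i l * kd j k + kd i k * kd j l - 2 / (N : ℝ) * (kd i j * kd k l)

/-- Antisymmetric structure `δᵢₗ δⱼₖ − δᵢₖ δⱼₗ` (channel `A⁻`). [cite: KosPolandSimmonsduffin2014ON, §2.1] -/
def tA (i j k l : Fin N) : ℝ := kd i l * kd j k - kd i k * kd j l

/-- The singlet structure is symmetric in `i ↔ j`. [cite: KosPolandSimmonsduffin2014ON, §2.1] -/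
theorem tS_symm (i j k l : Fin N) : tS j i k l = tS i j k l := by
  simp [tS, kd_comm i j]

/-- The channel-`T` structure is symmetric in `i ↔ j` ("symmetric tensors `𝒪_(ij)`"). [cite: KosPolandSimmonsduffin2014ON, §2.1] -/
theorem tT_symm (i j k l : Fin N) : tT j i k l = tT i j k l := by
  simp only [tT, kd_comm j i]; ring

/-- The channel-`A` structure is antisymmetric in `i ↔ j` ("anti-symmetric tensors `𝒪_[ij]`"). [cite: KosPolandSimmonsduffin2014ON, §2.1] -/
theorem tA_antisymm (i j k l : Fin N) : tA j i k l = -tA i j k l := by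
  simp only [tA]; ring

/-- `Σᵢ δᵢₖ δᵢₗ = δₖₗ`. Plumbing. [folklore] -/
private theorem sum_kd_mul_kd (k l : Fin N) : ∑ i, kd i k * kd i l = kd k l := by
  rw [Finset.sum_eq_single k]
  · simp
  · intro i _ hi; simp [kd_of_ne hi]
  · simp

/-- `tT` is traceless in its first pair: `Σᵢ tT i i k l = 0` (for `N ≠ 0`, so that `(2/N)·N = 2`).
[cite: KosPolandSimmonsduffin2014ON, §2.1] -/
theorem sum_tT_diag (hN : N ≠ 0) (k l : Fin N) : ∑ i, tT i i k l = 0 := by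
  have hN' : (N : ℝ) ≠ 0 := Nat.cast_ne_zero.mpr hN
  simp only [tT, kd_self, one_mul, Finset.sum_sub_distrib, Finset.sum_add_distrib, ← Finset.mul_sum,
    Finset.sum_const, Finset.card_univ, Fintype.card_fin, nsmul_eq_mul]
  rw [show ∑ i, kd i l * kd i k = kd l k from sum_kd_mul_kd l k, sum_kd_mul_kd k l, kd_comm l k]
  field_simp
  ring

/-- **Independence of the three tensor structures** (`2 ≤ N`): if
`a δᵢⱼδₖₗ + b δᵢₖδⱼₗ + c δᵢₗδⱼₖ = 0` for all indices then `a = b = c = 0` — the step "isolating the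
coefficient of each tensor structure".  (False for `N = 1`.) [cite: KosPolandSimmonsduffin2014ON, §2.1] -/
theorem tensor_independent (hN : 2 ≤ N) {a b c : ℝ}
    (h : ∀ i j k l : Fin N, a * (kd i j * kd k l) + b * (kd i k * kd j l) + c * (kd i l * kd j k) = 0) :
    a = 0 ∧ b = 0 ∧ c = 0 := by
  set x : Fin N := ⟨0, by omega⟩
  set y : Fin N := ⟨1, by omega⟩
  have hxy : x ≠ y := by simp [x, y, Fin.ext_iff]
  have h1 := h x x y y
  have h2 := h x y x y
  have h3 := h x y y x
  simp [kd_of_ne hxy, kd_of_ne hxy.symm] at h1 h2 h3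
  exact ⟨h1, h2, h3⟩

/-! ## §2 Channel functions, `F^±`, the vectors `V_S, V_T, V_A`, and crossing ⟺ sum rule (pointwise) -/

/-- The reduced correlator `x₁₂^{2Δφ}x₃₄^{2Δφ}⟨φᵢφⱼφₖφₗ⟩` as a function of the cross-ratios, expanded
on the three tensor structures against the channel sums `G_S, G_T, G_A` (`G_R(u,v) = Σ_{𝒪 ∈ R} λ²_𝒪 g_𝒪(u,v)`).
[cite: KosPolandSimmonsduffin2014ON, §2.1] -/
def corr (GS GT GA : ℝ → ℝ → ℝ) (i j k l : Fin N) (u v : ℝ) : ℝ :=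
  tS i j k l * GS u v + tT i j k l * GT u v + tA i j k l * GA u v

/-- Crossing symmetry under `(1,i) ↔ (3,k)` at the point `(u,v)` (both orderings of the cross-ratios
enter): `v^{Δφ} f_{ijkl}(u,v) = u^{Δφ} f_{kjil}(v,u)` for all indices.
[cite: KosPolandSimmonsduffin2014ON, §2.1] -/
def CrossingAt (N : ℕ) (Δφ : ℝ) (GS GT GA : ℝ → ℝ → ℝ) (u v : ℝ) : Prop :=
  ∀ i j k l : Fin N, v ^ Δφ * corr GS GT GA i j k l u v = u ^ Δφ * corr GS GT GA k j i l v u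

/-- `F⁻[g](u,v) = v^{Δφ} g(u,v) − u^{Δφ} g(v,u)`. [cite: KosPolandSimmonsduffin2014ON, §2.1] -/
def Fm (Δφ : ℝ) (g : ℝ → ℝ → ℝ) (u v : ℝ) : ℝ := v ^ Δφ * g u v - u ^ Δφ * g v u

/-- `F⁺[g](u,v) = v^{Δφ} g(u,v) + u^{Δφ} g(v,u)`. [cite: KosPolandSimmonsduffin2014ON, §2.1] -/
def Fp (Δφ : ℝ) (g : ℝ → ℝ → ℝ) (u v : ℝ) : ℝ := v ^ Δφ * g u v + u ^ Δφ * g v u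

/-- `V_S = (0, F⁻, F⁺)ᵀ`. [cite: KosPolandSimmonsduffin2014ON, §2.1] -/
def VS (Δφ : ℝ) (g : ℝ → ℝ → ℝ) (u v : ℝ) : Fin 3 → ℝ := ![0, Fm Δφ g u v, Fp Δφ g u v]

/-- `V_T = (F⁻, (1 − 2/N) F⁻, −(1 + 2/N) F⁺)ᵀ`. [cite: KosPolandSimmonsduffin2014ON, §2.1] -/
def VT (N : ℕ) (Δφ : ℝ) (g : ℝ → ℝ → ℝ) (u v : ℝ) : Fin 3 → ℝ :=
  ![Fm Δφ g u v, (1 - 2 / (N : ℝ)) * Fm Δφ g u v, -(1 + 2 / (N : ℝ)) * Fp Δφ g u v]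

/-- `V_A = (−F⁻, F⁻, −F⁺)ᵀ`. [cite: KosPolandSimmonsduffin2014ON, §2.1] -/
def VA (Δφ : ℝ) (g : ℝ → ℝ → ℝ) (u v : ℝ) : Fin 3 → ℝ := ![-Fm Δφ g u v, Fm Δφ g u v, -Fp Δφ g u v]

/-- The unit operator (`λ = 1`, block `g ≡ 1`, channel `S⁺`) contributes
`V_unit = V_S[1] = (0, v^{Δφ} − u^{Δφ}, v^{Δφ} + u^{Δφ})ᵀ`. [cite: KosPolandSimmonsduffin2014ON, §2.2] -/
theorem VS_unit (Δφ u v : ℝ) :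
    VS Δφ (fun _ _ => (1 : ℝ)) u v = ![0, v ^ Δφ - u ^ Δφ, v ^ Δφ + u ^ Δφ] := by
  simp [VS, Fm, Fp]

/-- The left-hand side of the vector sum rule at channel-sum level, `V_S[G_S] + V_T[G_T] + V_A[G_A]`
(`F^±` is linear in `g`, so `Σ_{𝒪∈R} λ² V_R[g_𝒪] = V_R[G_R]`, cf. §3). [cite: KosPolandSimmonsduffin2014ON, §2.1] -/
def sumRuleVec (N : ℕ) (Δφ : ℝ) (GS GT GA : ℝ → ℝ → ℝ) (u v : ℝ) : Fin 3 → ℝ :=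
  VS Δφ GS u v + VT N Δφ GT u v + VA Δφ GA u v

/-- The vector sum rule at the point `(u,v)`. [cite: KosPolandSimmonsduffin2014ON, §2.1] -/
def SumRuleAt (N : ℕ) (Δφ : ℝ) (GS GT GA : ℝ → ℝ → ℝ) (u v : ℝ) : Prop :=
  sumRuleVec N Δφ GS GT GA u v = 0

/-- First component of the vector sum rule: `F⁻[G_T] − F⁻[G_A]`. [cite: KosPolandSimmonsduffin2014ON, §2.1] -/
theorem sumRuleVec_zero (Δφ : ℝ) (GS GT GA : ℝ → ℝ → ℝ) (u v : ℝ) :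
    sumRuleVec N Δφ GS GT GA u v 0 = Fm Δφ GT u v - Fm Δφ GA u v := by
  simp [sumRuleVec, VS, VT, VA]; ring

/-- Second component: `F⁻[G_S] + (1 − 2/N) F⁻[G_T] + F⁻[G_A]`. [cite: KosPolandSimmonsduffin2014ON, §2.1] -/
theorem sumRuleVec_one (Δφ : ℝ) (GS GT GA : ℝ → ℝ → ℝ) (u v : ℝ) :
    sumRuleVec N Δφ GS GT GA u v 1 = Fm Δφ GS u v + (1 - 2 / (N : ℝ)) * Fm Δφ GT u v + Fm Δφ GA u v := by
  simp [sumRuleVec, VS, VT, VA]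

/-- Third component: `F⁺[G_S] − (1 + 2/N) F⁺[G_T] − F⁺[G_A]`. [cite: KosPolandSimmonsduffin2014ON, §2.1] -/
theorem sumRuleVec_two (Δφ : ℝ) (GS GT GA : ℝ → ℝ → ℝ) (u v : ℝ) :
    sumRuleVec N Δφ GS GT GA u v 2 = Fp Δφ GS u v - (1 + 2 / (N : ℝ)) * Fp Δφ GT u v - Fp Δφ GA u v := by
  simp [sumRuleVec, VS, VT, VA]; ring

/-- **The crossing defect on the three tensor structures** (pointwise, every `N`): with `r = sumRuleVec`,
`v^{Δφ} f_{ijkl}(u,v) − u^{Δφ} f_{kjil}(v,u) = δᵢⱼδₖₗ (r₂+r₃)/2 + δᵢₖδⱼₗ r₁ + δᵢₗδⱼₖ (r₂−r₃)/2`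
(indices of `r` written `0,1,2` below). [cite: KosPolandSimmonsduffin2014ON, §2.1] -/
theorem crossing_defect (Δφ : ℝ) (GS GT GA : ℝ → ℝ → ℝ) (i j k l : Fin N) (u v : ℝ) :
    v ^ Δφ * corr GS GT GA i j k l u v - u ^ Δφ * corr GS GT GA k j i l v u =
      kd i j * kd k l * ((sumRuleVec N Δφ GS GT GA u v 1 + sumRuleVec N Δφ GS GT GA u v 2) / 2)
      + kd i k * kd j l * sumRuleVec N Δφ GS GT GA u v 0
      + kd i l * kd j k * ((sumRuleVec N Δφ GS GT GA u v 1 - sumRuleVec N Δφ GS GT GA u v 2) / 2) := by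
  rw [sumRuleVec_zero, sumRuleVec_one, sumRuleVec_two]
  simp only [corr, tS, tT, tA, Fm, Fp]
  rw [kd_comm k j, kd_comm j i, kd_comm k i]
  ring

/-- **Crossing ⇒ vector sum rule** (pointwise; `2 ≤ N`). [cite: KosPolandSimmonsduffin2014ON, §2.1] -/
theorem sumRuleAt_of_crossingAt (hN : 2 ≤ N) {Δφ : ℝ} {GS GT GA : ℝ → ℝ → ℝ} {u v : ℝ}
    (h : CrossingAt N Δφ GS GT GA u v) : SumRuleAt N Δφ GS GT GA u v := by
  have key : ∀ i j k l : Fin N,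
      ((sumRuleVec N Δφ GS GT GA u v 1 + sumRuleVec N Δφ GS GT GA u v 2) / 2) * (kd i j * kd k l)
        + sumRuleVec N Δφ GS GT GA u v 0 * (kd i k * kd j l)
        + ((sumRuleVec N Δφ GS GT GA u v 1 - sumRuleVec N Δφ GS GT GA u v 2) / 2) * (kd i l * kd j k)
        = 0 := by
    intro i j k l
    have := crossing_defect Δφ GS GT GA i j k l u v
    rw [h i j k l, sub_self] at this
    linear_combination -this
  obtain ⟨h1, h2, h3⟩ := tensor_independent hN key
  funext r
  fin_cases r
  · simpa using h2
  · simp only [Fin.mk_one, Pi.zero_apply]; linear_combination h1 + h3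
  · simp only [Pi.zero_apply]
    have : sumRuleVec N Δφ GS GT GA u v 2 = 0 := by linear_combination h1 - h3
    simpa using this

/-- **Vector sum rule ⇒ crossing** (pointwise; every `N`). [cite: KosPolandSimmonsduffin2014ON, §2.1] -/
theorem crossingAt_of_sumRuleAt {Δφ : ℝ} {GS GT GA : ℝ → ℝ → ℝ} {u v : ℝ}
    (h : SumRuleAt N Δφ GS GT GA u v) : CrossingAt N Δφ GS GT GA u v := by
  intro i j k l
  rw [← sub_eq_zero, crossing_defect]
  have h0 := congr_fun h 0
  have h1 := congr_fun h 1
  have h2 := congr_fun h 2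
  simp only [Pi.zero_apply] at h0 h1 h2
  rw [h0, h1, h2]
  ring

/-- **Crossing symmetry at `(u,v)` is the vector sum rule at `(u,v)`** (`2 ≤ N`).
[cite: KosPolandSimmonsduffin2014ON, §2.1] -/
theorem crossingAt_iff_sumRuleAt (hN : 2 ≤ N) {Δφ : ℝ} {GS GT GA : ℝ → ℝ → ℝ} {u v : ℝ} :
    CrossingAt N Δφ GS GT GA u v ↔ SumRuleAt N Δφ GS GT GA u v :=
  ⟨sumRuleAt_of_crossingAt hN, crossingAt_of_sumRuleAt⟩

/-- Crossing symmetry at `(u,v)` and at `(v,u)` are the same condition (relabel `i ↔ k` and read the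
equation right to left); every `N`. [cite: KosPolandSimmonsduffin2014ON, §2.1] -/
theorem CrossingAt.swap {Δφ : ℝ} {GS GT GA : ℝ → ℝ → ℝ} {u v : ℝ} (h : CrossingAt N Δφ GS GT GA u v) :
    CrossingAt N Δφ GS GT GA v u :=
  fun i j k l => (h k j i l).symm

/-- `F⁻` is odd under `u ↔ v`. [cite: KosPolandSimmonsduffin2014ON, §2.1] -/
theorem Fm_swap (Δφ : ℝ) (g : ℝ → ℝ → ℝ) (u v : ℝ) : Fm Δφ g v u = -Fm Δφ g u v := by
  simp only [Fm]; ring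

/-- `F⁺` is even under `u ↔ v`. [cite: KosPolandSimmonsduffin2014ON, §2.1] -/
theorem Fp_swap (Δφ : ℝ) (g : ℝ → ℝ → ℝ) (u v : ℝ) : Fp Δφ g v u = Fp Δφ g u v := by
  simp only [Fp]; ring

/-- The sum rule at `(u,v)` as its three scalar equations. [cite: KosPolandSimmonsduffin2014ON, §2.1] -/
theorem sumRuleAt_iff {Δφ : ℝ} {GS GT GA : ℝ → ℝ → ℝ} {u v : ℝ} :
    SumRuleAt N Δφ GS GT GA u v ↔
      sumRuleVec N Δφ GS GT GA u v 0 = 0 ∧ sumRuleVec N Δφ GS GT GA u v 1 = 0 ∧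
        sumRuleVec N Δφ GS GT GA u v 2 = 0 := by
  constructor
  · intro h; exact ⟨congr_fun h 0, congr_fun h 1, congr_fun h 2⟩
  · rintro ⟨h0, h1, h2⟩
    funext r
    fin_cases r
    · simpa using h0
    · simpa using h1
    · simpa using h2

/-- Under `u ↔ v` the two `F⁻` rows of the sum rule change sign and the `F⁺` row is unchanged, so the
sum rule at `(v,u)` is the sum rule at `(u,v)`: a functional need only sample one of each mirror pair
(the paper works at the symmetric point `z = z̄ = 1/2`). [cite: KosPolandSimmonsduffin2014ON, §2.1] -/
theorem sumRuleAt_swap_iff {Δφ : ℝ} {GS GT GA : ℝ → ℝ → ℝ} {u v : ℝ} :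
    SumRuleAt N Δφ GS GT GA v u ↔ SumRuleAt N Δφ GS GT GA u v := by
  rw [sumRuleAt_iff, sumRuleAt_iff, sumRuleVec_zero, sumRuleVec_one, sumRuleVec_two, sumRuleVec_zero,
    sumRuleVec_one, sumRuleVec_two, Fm_swap Δφ GS, Fm_swap Δφ GT, Fm_swap Δφ GA, Fp_swap Δφ GS,
    Fp_swap Δφ GT, Fp_swap Δφ GA]
  constructor
  · rintro ⟨h0, h1, h2⟩; exact ⟨by linarith, by linarith, h2⟩
  · rintro ⟨h0, h1, h2⟩; exact ⟨by linarith, by linarith, h2⟩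

/-- Scope remark (ours, kept private): for `N = 1` the forward direction fails — `tT = 0`, so crossing
constrains `G_S` only. [folklore] -/
private theorem tT_eq_zero_of_one (i j k l : Fin 1) : tT i j k l = 0 := by
  obtain rfl := Subsingleton.elim i j; obtain rfl := Subsingleton.elim i k; obtain rfl := Subsingleton.elim i l
  simp [tT]
  norm_num

/-- Scope remark (ours, kept private): for `N = 1`, `tA = 0`. [folklore] -/
private theorem tA_eq_zero_of_one (i j k l : Fin 1) : tA i j k l = 0 := by
  obtain rfl := Subsingleton.elim i j; obtain rfl := Subsingleton.elim i k; obtain rfl := Subsingleton.elim i l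
  simp [tA]

/-- Scope remark (ours, kept private): for `N = 1` the reduced correlator is `G_S` alone and
`CrossingAt 1` says only `F⁻[G_S] = 0` — the hypothesis `2 ≤ N` of `sumRuleAt_of_crossingAt` is needed.
[folklore] -/
private theorem crossingAt_one_iff {Δφ : ℝ} {GS GT GA : ℝ → ℝ → ℝ} {u v : ℝ} :
    CrossingAt 1 Δφ GS GT GA u v ↔ Fm Δφ GS u v = 0 := by
  simp only [CrossingAt, corr, tT_eq_zero_of_one, tA_eq_zero_of_one, zero_mul, add_zero, Fm]
  constructor
  · intro h
    have := h 0 0 0 0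
    simp [tS] at this
    linarith
  · intro h i j k l
    obtain rfl := Subsingleton.elim i j; obtain rfl := Subsingleton.elim i k
    obtain rfl := Subsingleton.elim i l
    simp [tS]
    linarith

/-! ## §3 Operator level: the channel expansions pass through `F^±` and `V_R` -/

section Series

variable {ι : Type*} {p : ι → ℝ} {g : ι → ℝ → ℝ → ℝ} {G : ℝ → ℝ → ℝ} {u v : ℝ}

/-- `F⁻` commutes with a convergent channel expansion `G(u,v) = Σ_𝒪 λ²_𝒪 g_𝒪(u,v)` (needed at `(u,v)`
and at `(v,u)`). [cite: KosPolandSimmonsduffin2014ON, §2.1] -/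
theorem hasSum_Fm (Δφ : ℝ) (h1 : HasSum (fun o => p o * g o u v) (G u v))
    (h2 : HasSum (fun o => p o * g o v u) (G v u)) :
    HasSum (fun o => p o * Fm Δφ (g o) u v) (Fm Δφ G u v) := by
  have hfun : (fun o => p o * Fm Δφ (g o) u v) =
      fun o => v ^ Δφ * (p o * g o u v) - u ^ Δφ * (p o * g o v u) := by
    funext o; simp only [Fm]; ring
  rw [hfun, Fm]
  exact (h1.mul_left (v ^ Δφ)).sub (h2.mul_left (u ^ Δφ))

/-- `F⁺` commutes with a convergent channel expansion. [cite: KosPolandSimmonsduffin2014ON, §2.1] -/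
theorem hasSum_Fp (Δφ : ℝ) (h1 : HasSum (fun o => p o * g o u v) (G u v))
    (h2 : HasSum (fun o => p o * g o v u) (G v u)) :
    HasSum (fun o => p o * Fp Δφ (g o) u v) (Fp Δφ G u v) := by
  have hfun : (fun o => p o * Fp Δφ (g o) u v) =
      fun o => v ^ Δφ * (p o * g o u v) + u ^ Δφ * (p o * g o v u) := by
    funext o; simp only [Fp]; ring
  rw [hfun, Fp]
  exact (h1.mul_left (v ^ Δφ)).add (h2.mul_left (u ^ Δφ))

/-- `Σ_𝒪 λ² V_S[g_𝒪] = V_S[G_S]`. [cite: KosPolandSimmonsduffin2014ON, §2.1] -/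
theorem hasSum_VS (Δφ : ℝ) (h1 : HasSum (fun o => p o * g o u v) (G u v))
    (h2 : HasSum (fun o => p o * g o v u) (G v u)) :
    HasSum (fun o => p o • VS Δφ (g o) u v) (VS Δφ G u v) := by
  rw [Pi.hasSum]
  intro r
  fin_cases r
  · simp [VS]
  · simpa [VS] using hasSum_Fm Δφ h1 h2
  · simpa [VS] using hasSum_Fp Δφ h1 h2

/-- `Σ_𝒪 λ² V_T[g_𝒪] = V_T[G_T]`. [cite: KosPolandSimmonsduffin2014ON, §2.1] -/
theorem hasSum_VT (Δφ : ℝ) (h1 : HasSum (fun o => p o * g o u v) (G u v))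
    (h2 : HasSum (fun o => p o * g o v u) (G v u)) :
    HasSum (fun o => p o • VT N Δφ (g o) u v) (VT N Δφ G u v) := by
  rw [Pi.hasSum]
  intro r
  fin_cases r
  · simpa [VT] using hasSum_Fm Δφ h1 h2
  · have := (hasSum_Fm Δφ h1 h2).mul_left (1 - 2 / (N : ℝ))
    simpa [VT, mul_left_comm] using this
  · have := (hasSum_Fp Δφ h1 h2).mul_left (-(1 + 2 / (N : ℝ)))
    simpa [VT, mul_left_comm] using this

/-- `Σ_𝒪 λ² V_A[g_𝒪] = V_A[G_A]`. [cite: KosPolandSimmonsduffin2014ON, §2.1] -/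
theorem hasSum_VA (Δφ : ℝ) (h1 : HasSum (fun o => p o * g o u v) (G u v))
    (h2 : HasSum (fun o => p o * g o v u) (G v u)) :
    HasSum (fun o => p o • VA Δφ (g o) u v) (VA Δφ G u v) := by
  rw [Pi.hasSum]
  intro r
  fin_cases r
  · have := (hasSum_Fm Δφ h1 h2).neg
    simpa [VA, mul_neg] using this
  · simpa [VA] using hasSum_Fm Δφ h1 h2
  · have := (hasSum_Fp Δφ h1 h2).neg
    simpa [VA, mul_neg] using this

end Series

/-- **The vector sum rule, series form** (`2 ≤ N`): if the three channel expansions converge at `(u,v)`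
and at `(v,u)` and the correlator is crossing symmetric at `(u,v)`, then
`Σ_{S⁺} λ² V_S + Σ_{T⁺} λ² V_T + Σ_{A⁻} λ² V_A = 0` there — each series converging to `V_R[G_R]` and the
three limits adding to zero. [cite: KosPolandSimmonsduffin2014ON, §2.1] -/
theorem vectorSumRule_hasSum (hN : 2 ≤ N) {ιS ιT ιA : Type*} {pS : ιS → ℝ} {pT : ιT → ℝ}
    {pA : ιA → ℝ} {gS : ιS → ℝ → ℝ → ℝ} {gT : ιT → ℝ → ℝ → ℝ} {gA : ιA → ℝ → ℝ → ℝ}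
    {GS GT GA : ℝ → ℝ → ℝ} {u v : ℝ} (Δφ : ℝ)
    (hS : HasSum (fun o => pS o * gS o u v) (GS u v)) (hS' : HasSum (fun o => pS o * gS o v u) (GS v u))
    (hT : HasSum (fun o => pT o * gT o u v) (GT u v)) (hT' : HasSum (fun o => pT o * gT o v u) (GT v u))
    (hA : HasSum (fun o => pA o * gA o u v) (GA u v)) (hA' : HasSum (fun o => pA o * gA o v u) (GA v u))
    (hx : CrossingAt N Δφ GS GT GA u v) :
    HasSum (fun o => pS o • VS Δφ (gS o) u v) (VS Δφ GS u v) ∧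
      HasSum (fun o => pT o • VT N Δφ (gT o) u v) (VT N Δφ GT u v) ∧
      HasSum (fun o => pA o • VA Δφ (gA o) u v) (VA Δφ GA u v) ∧
      VS Δφ GS u v + VT N Δφ GT u v + VA Δφ GA u v = 0 :=
  ⟨hasSum_VS Δφ hS hS', hasSum_VT Δφ hT hT', hasSum_VA Δφ hA hA', sumRuleAt_of_crossingAt hN hx⟩

/-- `tsum` form of `vectorSumRule_hasSum`. [cite: KosPolandSimmonsduffin2014ON, §2.1] -/
theorem vectorSumRule_tsum (hN : 2 ≤ N) {ιS ιT ιA : Type*} {pS : ιS → ℝ} {pT : ιT → ℝ}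
    {pA : ιA → ℝ} {gS : ιS → ℝ → ℝ → ℝ} {gT : ιT → ℝ → ℝ → ℝ} {gA : ιA → ℝ → ℝ → ℝ}
    {GS GT GA : ℝ → ℝ → ℝ} {u v : ℝ} (Δφ : ℝ)
    (hS : HasSum (fun o => pS o * gS o u v) (GS u v)) (hS' : HasSum (fun o => pS o * gS o v u) (GS v u))
    (hT : HasSum (fun o => pT o * gT o u v) (GT u v)) (hT' : HasSum (fun o => pT o * gT o v u) (GT v u))
    (hA : HasSum (fun o => pA o * gA o u v) (GA u v)) (hA' : HasSum (fun o => pA o * gA o v u) (GA v u))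
    (hx : CrossingAt N Δφ GS GT GA u v) :
    ∑' o, pS o • VS Δφ (gS o) u v + ∑' o, pT o • VT N Δφ (gT o) u v + ∑' o, pA o • VA Δφ (gA o) u v = 0 := by
  obtain ⟨h1, h2, h3, h4⟩ := vectorSumRule_hasSum hN Δφ hS hS' hT hT' hA hA' hx
  rw [h1.tsum_eq, h2.tsum_eq, h3.tsum_eq, h4]

/-! ## §4 The linear-functional exclusion step -/

/-- **The exclusion argument** (abstract form, any real vector space): a linear functional `α` with
`α(V_𝒪) ≥ 0` for every exchanged `𝒪`, `α(V_unit) > 0`, which applies termwise to the unit-isolated sum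
rule `0 = V_unit + Σ_𝒪 λ²_𝒪 V_𝒪` (`λ²_𝒪 ≥ 0`), cannot exist.  "Applies termwise" is the hypothesis
`happ`; it is automatic for finite combinations of point evaluations (`hasSum_pointFunctional`).
[cite: KosPolandSimmonsduffin2014ON, §2.2] -/
theorem false_of_functional {ι X : Type*} [AddCommGroup X] [Module ℝ X] (α : X →ₗ[ℝ] ℝ) {Vunit : X}
    {V : ι → X} {p : ι → ℝ} (hp : ∀ o, 0 ≤ p o)
    (happ : HasSum (fun o => p o * α (V o)) (-(α Vunit)))
    (hpos : ∀ o, 0 ≤ α (V o)) (hunit : 0 < α Vunit) : False := by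
  have h0 : 0 ≤ -(α Vunit) := happ.nonneg fun o => mul_nonneg (hp o) (hpos o)
  linarith

/-- A finite combination of point evaluations of the three components,
`α(F) = Σ_m Σ_r w m r · F(u_m, v_m)_r` for `F : ℝ → ℝ → (Fin 3 → ℝ)` — crossing imposed point by point
(Hogervorst–Rychkov 2013, §4.3; the three-component analogue of `ConformalBootstrap3D.pointFunctional`);
the simplest members of the "vector space of linear functionals" of the cited §2.2.
[cite: HogervorstRychkov2013, §4.3] [cite: KosPolandSimmonsduffin2014ON, §2.2] -/
def pointFunctional {M : ℕ} (w : Fin M → Fin 3 → ℝ) (u v : Fin M → ℝ) :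
    (ℝ → ℝ → Fin 3 → ℝ) →ₗ[ℝ] ℝ where
  toFun F := ∑ m, ∑ r, w m r * F (u m) (v m) r
  map_add' F F' := by
    simp only [Pi.add_apply, mul_add, Finset.sum_add_distrib]
  map_smul' c F := by
    simp only [Pi.smul_apply, smul_eq_mul, RingHom.id_apply, Finset.mul_sum]
    refine Finset.sum_congr rfl fun m _ => Finset.sum_congr rfl fun r _ => ?_
    ring

/-- Unfolding of `pointFunctional`. [cite: HogervorstRychkov2013, §4.3] -/
theorem pointFunctional_apply {M : ℕ} (w : Fin M → Fin 3 → ℝ) (u v : Fin M → ℝ)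
    (F : ℝ → ℝ → Fin 3 → ℝ) : pointFunctional w u v F = ∑ m, ∑ r, w m r * F (u m) (v m) r := rfl

/-- Point functionals apply termwise: pointwise convergence of a vector-valued series at the evaluation
points gives convergence of the applied series, with no further hypothesis.
[cite: KosPolandSimmonsduffin2014ON, §2.2] -/
theorem hasSum_pointFunctional {M : ℕ} (w : Fin M → Fin 3 → ℝ) (u v : Fin M → ℝ) {ι : Type*}
    {f : ι → ℝ → ℝ → Fin 3 → ℝ} {a : ℝ → ℝ → Fin 3 → ℝ}
    (h : ∀ m, HasSum (fun o => f o (u m) (v m)) (a (u m) (v m))) :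
    HasSum (fun o => pointFunctional w u v (f o)) (pointFunctional w u v a) := by
  simp only [pointFunctional_apply]
  refine hasSum_sum fun m _ => hasSum_sum fun r _ => ?_
  exact ((Pi.hasSum.mp (h m)) r).mul_left (w m r)

/-- **Exclusion by a point functional, all hypotheses explicit** (`2 ≤ N`).  Data: channel expansions
indexed by `ιS` (singlets OTHER than the unit operator), `ιT`, `ιA`, with weights `λ² ≥ 0` and channel
functions `g`; channel sums `G_S` (INCLUDING the unit contribution `g_unit = 1`, `λ_unit = 1`), `G_T`,
`G_A`; evaluation points `(u_m, v_m)`.  Hypotheses: the expansions converge at every `(u_m, v_m)` and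
`(v_m, u_m)`; crossing symmetry holds at every `(u_m, v_m)`; the functional `α = pointFunctional w u v` is
`≥ 0` on every `V_R[g_𝒪]` and `> 0` on `V_unit = V_S[1]`.  Conclusion: contradiction — the assumed
spectrum (encoded by the index sets) is ruled out. [cite: KosPolandSimmonsduffin2014ON, §2.2] -/
theorem false_of_pointFunctional (hN : 2 ≤ N) {M : ℕ} (w : Fin M → Fin 3 → ℝ) (u v : Fin M → ℝ)
    {ιS ιT ιA : Type*} {pS : ιS → ℝ} {pT : ιT → ℝ} {pA : ιA → ℝ}
    {gS : ιS → ℝ → ℝ → ℝ} {gT : ιT → ℝ → ℝ → ℝ} {gA : ιA → ℝ → ℝ → ℝ} {GS GT GA : ℝ → ℝ → ℝ} (Δφ : ℝ)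
    (hpS : ∀ o, 0 ≤ pS o) (hpT : ∀ o, 0 ≤ pT o) (hpA : ∀ o, 0 ≤ pA o)
    (hS : ∀ m, HasSum (fun o => pS o * gS o (u m) (v m)) (GS (u m) (v m) - 1))
    (hS' : ∀ m, HasSum (fun o => pS o * gS o (v m) (u m)) (GS (v m) (u m) - 1))
    (hT : ∀ m, HasSum (fun o => pT o * gT o (u m) (v m)) (GT (u m) (v m)))
    (hT' : ∀ m, HasSum (fun o => pT o * gT o (v m) (u m)) (GT (v m) (u m)))
    (hA : ∀ m, HasSum (fun o => pA o * gA o (u m) (v m)) (GA (u m) (v m)))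
    (hA' : ∀ m, HasSum (fun o => pA o * gA o (v m) (u m)) (GA (v m) (u m)))
    (hx : ∀ m, CrossingAt N Δφ GS GT GA (u m) (v m))
    (hposS : ∀ o, 0 ≤ pointFunctional w u v (fun u' v' => VS Δφ (gS o) u' v'))
    (hposT : ∀ o, 0 ≤ pointFunctional w u v (fun u' v' => VT N Δφ (gT o) u' v'))
    (hposA : ∀ o, 0 ≤ pointFunctional w u v (fun u' v' => VA Δφ (gA o) u' v'))
    (hunit : 0 < pointFunctional w u v (fun u' v' => VS Δφ (fun _ _ => (1 : ℝ)) u' v')) : False := by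
  -- the functional
  set α := pointFunctional w u v with hα
  -- the unit-subtracted singlet channel sum `G_S − 1` and its expansion
  set GS' : ℝ → ℝ → ℝ := fun u' v' => GS u' v' - 1 with hGS'
  have hS1 : ∀ m, HasSum (fun o => pS o * gS o (u m) (v m)) (GS' (u m) (v m)) := fun m => by
    simpa [hGS'] using hS m
  have hS1' : ∀ m, HasSum (fun o => pS o * gS o (v m) (u m)) (GS' (v m) (u m)) := fun m => by
    simpa [hGS'] using hS' m
  -- the three applied channel series
  have eS : HasSum (fun o => pS o * α (fun u' v' => VS Δφ (gS o) u' v'))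
      (α (fun u' v' => VS Δφ GS' u' v')) := by
    have := hasSum_pointFunctional w u v (f := fun o => pS o • fun u' v' => VS Δφ (gS o) u' v')
      (a := fun u' v' => VS Δφ GS' u' v') ?_
    · simpa [hα, map_smul, smul_eq_mul] using this
    · intro m; exact hasSum_VS Δφ (hS1 m) (hS1' m)
  have eT : HasSum (fun o => pT o * α (fun u' v' => VT N Δφ (gT o) u' v'))
      (α (fun u' v' => VT N Δφ GT u' v')) := by
    have := hasSum_pointFunctional w u v (f := fun o => pT o • fun u' v' => VT N Δφ (gT o) u' v')
      (a := fun u' v' => VT N Δφ GT u' v') ?_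
    · simpa [hα, map_smul, smul_eq_mul] using this
    · intro m; exact hasSum_VT Δφ (hT m) (hT' m)
  have eA : HasSum (fun o => pA o * α (fun u' v' => VA Δφ (gA o) u' v'))
      (α (fun u' v' => VA Δφ GA u' v')) := by
    have := hasSum_pointFunctional w u v (f := fun o => pA o • fun u' v' => VA Δφ (gA o) u' v')
      (a := fun u' v' => VA Δφ GA u' v') ?_
    · simpa [hα, map_smul, smul_eq_mul] using this
    · intro m; exact hasSum_VA Δφ (hA m) (hA' m)
  -- non-negativity of the three applied series
  have nS : 0 ≤ α (fun u' v' => VS Δφ GS' u' v') :=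
    eS.nonneg fun o => mul_nonneg (hpS o) (hposS o)
  have nT : 0 ≤ α (fun u' v' => VT N Δφ GT u' v') :=
    eT.nonneg fun o => mul_nonneg (hpT o) (hposT o)
  have nA : 0 ≤ α (fun u' v' => VA Δφ GA u' v') :=
    eA.nonneg fun o => mul_nonneg (hpA o) (hposA o)
  -- the sum rule at every evaluation point, with the unit operator isolated: `V_S[G_S] = V_S[1] + V_S[G_S − 1]`
  have split : (fun u' v' => VS Δφ GS u' v') =
      (fun u' v' => VS Δφ (fun _ _ => (1 : ℝ)) u' v') + fun u' v' => VS Δφ GS' u' v' := by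
    funext u' v' r
    simp only [Pi.add_apply]
    fin_cases r <;> simp [VS, Fm, Fp, hGS'] <;> ring
  have zero : α (fun u' v' => VS Δφ GS u' v') + α (fun u' v' => VT N Δφ GT u' v')
      + α (fun u' v' => VA Δφ GA u' v') = 0 := by
    rw [← map_add, ← map_add]
    have hvan : ((fun u' v' => VS Δφ GS u' v') + (fun u' v' => VT N Δφ GT u' v')
        + fun u' v' => VA Δφ GA u' v') = fun u' v' => sumRuleVec N Δφ GS GT GA u' v' := by
      funext u' v'; simp [sumRuleVec]
    rw [hvan, hα, pointFunctional_apply]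
    refine Finset.sum_eq_zero fun m _ => Finset.sum_eq_zero fun r _ => ?_
    have := sumRuleAt_of_crossingAt hN (hx m)
    rw [SumRuleAt] at this
    simp [this]
  rw [split, map_add] at zero
  linarith

end

end Literature.MathematicalPhysics.QuantumFieldTheory.ONVectorSumRule
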